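import Literature.RingTheory.IntegralClosure.DedekindMertensLemma
import Literature.NumberTheory.ComplexMultiplication.CMAlgebraLatticePowersInvertible
import Mathlib.RingTheory.Localization.AsSubring
import Mathlib.RingTheory.Localization.AtPrime.Basic
import Mathlib.RingTheory.FractionalIdeal.Operations
import Mathlib.LinearAlgebra.Matrix.ToLinearEquiv
import Mathlib.LinearAlgebra.Matrix.Adjugate
import HarnessLib

/-!
# THE CONTENT FORMULA FOR LATTICES AND DADE–TAUSSKY–ZASSENHAUS'S THEOREM C: for every full lattice `L` of
# `Y = L_1 ⊕ ⋯ ⊕ L_t`, `n = dim_ℚ Y`, every power `L^k` with `k ≥ n − 1` is invertible (HL 2026 Thm. 10.1,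
# unconditionally), via the Dedekind–Mertens–Heinzer–Huneke formula `c(f)^n·c(g) = c(f)^{n−1}·c(fg)` for the
# `ℤ`-contents of ANY two polynomials `f, g ∈ Y[X]`

Topic `Literature/NumberTheory/ComplexMultiplication`, namespace `Literature.NumberTheory.ComplexMultiplication`; lane
`lit-hodgefound` (Track 2 foundations library), Layer A3, seat p19 generation 34, rows g34-#2 (§§1–4) and g34-#7 (§5) — sequel of g34-#1
(`Literature/RingTheory/IntegralClosure/DedekindMertensLemma`: HH Lemma 2.2 for `R`-contents over a local `R`) and of
g33-#1∕#2∕#3 (`CMAlgebraLatticePowersInvertible`, `…LargePrimes`, `…WeakClassWithoutUnitRepresentative`: HL Thm. 10.1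
under local generators, at large primes, in dimension `2`, and the counterexample to HL Thm. 10.3 (b) as printed).
THEOREMS ONLY: no definition, no instance, no named fact (D-0026, net Literature debt `0`), no `sorry`.

## Sources, VERBATIM

C. Hertling, K. Larabi, *Semigroups from full lattices in commutative ℚ-algebras*, arXiv:2602.14973 (2026)
[HertlingLarabi2026], §10 (chunk p0026): «A main result in [DTZ62] is Theorem C in section 1.5. It says that if
`A` is an algebraic number field of dimension `n ∈ ℤ_{≥2}` then for each full lattice `L ∈ 𝓛(A)` each power `L^k`
with `k ≥ n−1` is invertible. This result was generalized in [Si70] to the case when `A` is separable […].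
**Theorem 10.1.** Let `A` be a commutative ℚ-algebra of dimension `n ∈ ℤ_{≥2}` with unit element `1_A`. For each
full lattice `L ∈ 𝓛(A)` each power `L^k` with `k ≥ n−1` is invertible.»  (HL's proof goes through Thm. 10.3 (b),
which fails as printed — `CMAlgebraLatticeWeakClassWithoutUnitRepresentative`; the sources [DTZ62] = E. C. Dade,
O. Taussky, H. Zassenhaus, Math. Ann. 148 (1962) 31–64, §1.5 Theorem C [DadeTausskyZassenhaus1962] and [Si70] =
M. Singer, Proc. Cambridge Philos. Soc. 67 (1970) 237–242 [Singer1970] are not held: acq-11370, acq-13810.)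

W. Heinzer, C. Huneke, *The Dedekind–Mertens Lemma and the contents of polynomials*, Proc. AMS 126 (1998) 1305–1309
[HeinzerHuneke1998], Thm. 2.1 and its reduction (p. 1307): «If for each maximal ideal `m` of `R`, `c(g)R_m` is
generated in `R_m` by `k` elements, then the Dedekind-Mertens number `μ(g) ≤ k`. *Proof.* Since
`c(f)^nc(f)c(g) = c(f)^nc(fg)` holds in `R` if and only if `c(f)^nc(f)c(g)R_m = c(f)^nc(fg)R_m` for each maximal
ideal `m` of `R`, […] we may assume that the ring `R` is local», and footnote 1 (p. 1306): «the theorem which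
Dedekind proved (see [De]) said that if `f` and `g` are polynomials whose coefficients are algebraic numbers such that
the coefficients of `fg` are algebraic integers, then the product of any coefficient of `f` with an arbitrary
coefficient of `g` is also an algebraic integer».  J. T. Arnold, R. Gilmer, Proc. AMS 24 (1970) 556–562
[ArnoldGilmer1970], p. 556: the `R`-content `A_f` («the `R`-submodule of `S` generated by» the coefficients) for a
subring `R` of a commutative ring `S`, and Prüfer's theorem for the fractional ideals «generated by the coefficients»
over a domain with quotient field `K`.

## What is proved (all for `Y = ∏ᵢ Lᵢ`, `Lᵢ` number fields, `n = finrank ℚ Y`; the `ℤ`-content of `f ∈ Y[X]` is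
## `Submodule.span ℤ ↑f.coeffs`, a lattice of `Y`)

* §1 (any field `K`, commutative `K`-algebra with a finite basis `b`): the NORM COFACTOR — for `f = ∑ b_iX^i` there is
  `g ∈ B[X]` with `f·g = ν ∈ K[X] ∖ 0` (`ν = det Φ`, `Φ = ∑ X^i·[b_i]` the matrix of `f`, `g = adj(Φ)·1`; `ν ≠ 0`
  by McCoy's theorem); and the `ℤ`-content of a nonzero `ν ∈ ℚ[X]` read in `Y` is `ℤ·c·1` with `c ∈ ℚ^×` (contents
  over `ℚ = Frac ℤ` are principal fractional ideals — Gauss ∕ Prüfer).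
* §2 `ℤ ⇢ ℤ_(p)`: with `ℤ_(p) ⊂ ℚ` Mathlib's `Localization.subalgebra.ofField`, `x ∈ ℤ_(p)·P ⟹ ∃ s, p ∤ s, sx ∈ P`
  (the tree's `p`-local membership of `CMAlgebraLatticeLocalization`), and `S·(PQ) = (S·P)(S·Q)`, `S·P^j = (S·P)^j`
  for any ring of scalars `S`.
* §3 **THE DEDEKIND–MERTENS NUMBER OF EVERY `g ∈ Y[X]` IS AT MOST `n`:** `c(f)^n·c(g) ⊆ c(f)^{n−1}·c(fg)` and
  `c(f)^n·c(g) = c(f)^{n−1}·c(fg)` for ALL `f, g ∈ Y[X]` (`span_coeffs_pow_finrank_mul_le`, `…_eq`): `c(g)` is free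
  of rank `≤ n`, so `ℤ_(p)c(g)` is spanned by `≤ n` elements and HH Lemma 2.2 (g34-#1) applies at every prime; HH's
  «holds in `R` iff it holds in each `R_m`» is the tree's `mem_of_forall_prime_exists_not_dvd_smul_mem`.
* §4 **DTZ62 THEOREM C ∕ HL THM. 10.1 ∕ Si70, UNCONDITIONALLY** (`pow_mul_div_div_eq`: `M` full, `k ≥ n − 1` ⟹
  `M^k·(𝒪(M^k):M^k) = 𝒪(M^k)`; `exists_order_forall_pow_mul_div_div_eq`: one order `Λ_2 = 𝒪(M^k)` for all `k ≥ n−1`,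
  as in HL's statement of the proof).  PROOF (the tree's; not HL's local-representative argument, not DTZ's): with a
  `ℤ`-basis `ω` of `M`, `f := ∑ ω_iX^i` has `c(f) = M`; its norm cofactor `g` has `c(fg) = ℤu`, `u = c·1 ∈ Y^×`; §3
  gives `M^n·N = u·M^{n−1}` for `N := c(g)`, hence `M^{k+1}N = uM^k` for `k ≥ n−1`; then `E := u⁻¹MN ∋ 1` (as
  `u ∈ c(fg) ⊆ MN`), `E·M^k = M^k`, `E^{k+1} = E^k =: Λ_2` for `k ≥ n−1`, so `Λ_2` is an order inside `𝒪(M^k)` with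
  `M^k·(u^{−k}N^k) = Λ_2`, and `M^k·(u^{−k}N^k·𝒪(M^k)) = 𝒪(M^k) = Λ_2` — invertibility by the tree's
  `mul_div_div_eq_of_exists_mul_eq` (HL Thm. 5.6 (c)).  No residue field enters: the obstruction that breaks HL
  Thm. 10.3 (b) (more than `p` maximal ideals above a prime `p < n`) is invisible to the content formula.
* §5 (row g34-#7) **THEOREM 1.3 (e) IN THE SEMIGROUP `W(𝓛(Y))` OF WEAK CLASSES** (weak equivalence written
  `1 ∈ (L_1:L_2)(L_2:L_1)` as in `CMAlgebraLatticeWeakEquivalence`): for `M` full and `k, k' ≥ n − 1`,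
  `M^k ∼_w 𝒪(M^k)` (`one_mem_pow_div_order_mul_order_div_pow` — «`G(c) = [c]_w`», HL's closing line
  «`L^{n−1+l} ∼_w … = Λ_2`»), `M^k ∼_w M^{k'}` (`one_mem_pow_div_pow_mul_pow_div_pow`), and the class `[M^k]_w` is
  idempotent, `M^kM^k ∼_w M^k` (`one_mem_pow_mul_pow_div_pow_mul_pow_div_pow_mul_pow`; Thm. 4.4 (c)).
NOT here: HL Thm. 10.2 (`= pic_pi_integralClosure_iff`), Dedekind–Mertens numbers as a notion, Dedekind's
integrality corollary («Prague theorem», see `CMAlgebraDedekindPragueTheorem`).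

## References
* [HertlingLarabi2026] C. Hertling, K. Larabi, arXiv:2602.14973 (2026), §10 Thm. 10.1 (chunk p0026) and the end of
  its proof (chunk p0028); §1 Lemma 1.2, Thm. 1.3 (e) (chunk p0003); §4 Thm. 4.4; §5 Thm. 5.6 (c), 5.8 (b); §7 Def. 7.1,
  Thm. 7.2. [cite: HertlingLarabi2026, §10 Thm. 10.1, chunk p0026]
* [DadeTausskyZassenhaus1962] E. C. Dade, O. Taussky, H. Zassenhaus, Math. Ann. 148 (1962) 31–64, §1.5 Theorem C (as
  cited by HL 2026 §10; not held, acq-11370). [cite: DadeTausskyZassenhaus1962, §1.5 Theorem C (as cited by HertlingLarabi2026 §10)]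
* [Singer1970] M. Singer, Proc. Cambridge Philos. Soc. 67 (1970) 237–242 (the separable case, as cited by HL 2026 §10;
  not held, acq-13810). [cite: Singer1970, main theorem (as cited by HertlingLarabi2026 §10)]
* [HeinzerHuneke1998] W. Heinzer, C. Huneke, Proc. AMS 126 (1998) 1305–1309, Thm. 2.1 (local-to-global step),
  Lemma 2.2, footnote 1. [cite: HeinzerHuneke1998, Thm. 2.1 and Lemma 2.2, p. 1307]
* [ArnoldGilmer1970] J. T. Arnold, R. Gilmer, Proc. AMS 24 (1970) 556–562, p. 556 (R-content; Prüfer's theorem).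
  [cite: ArnoldGilmer1970, p. 556]
-/

noncomputable section

open scoped Classical Polynomial Pointwise nonZeroDivisors NumberField
open Polynomial Submodule Module
open Literature.RingTheory.IntegralClosure.DedekindMertens

namespace Literature.NumberTheory.ComplexMultiplication

/-! ## §1 The norm cofactor of `∑ bᵢXⁱ`, and the content of a rational polynomial -/

section Cofactor

variable {K B : Type*} [Field K] [CommRing B] [Algebra K B]

/-- Coefficients of `∑_{i<n} a_i X^i`. [cite: ArnoldGilmer1970, Lemma 1, p. 556] -/
theorem coeff_sum_C_mul_X_pow {A : Type*} [Semiring A] {n : ℕ} (a : Fin n → A) (m : ℕ) :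
    (∑ i : Fin n, C (a i) * X ^ (i : ℕ)).coeff m = if h : m < n then a ⟨m, h⟩ else 0 := by
  rw [finsetSum_coeff]
  simp_rw [coeff_C_mul_X_pow]
  split_ifs with h
  · rw [Finset.sum_eq_single ⟨m, h⟩ (fun i _ hi => if_neg fun e => hi (Fin.ext e.symm)) (fun hh => absurd (Finset.mem_univ _) hh),
      if_pos rfl]
  · exact Finset.sum_eq_zero fun i _ => if_neg fun e : m = (i : ℕ) => h (by rw [e]; exact i.2)

/-- The `R`-content of `∑_{i<n} a_iX^i` is `⟨a_0,…,a_{n−1}⟩_R`. [cite: ArnoldGilmer1970, Lemma 1, p. 556] -/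
theorem span_coeffs_sum_C_mul_X_pow {R A : Type*} [CommRing R] [CommRing A] [Algebra R A] {n : ℕ} (a : Fin n → A) :
    span R ((∑ i : Fin n, C (a i) * X ^ (i : ℕ)).coeffs : Set A) = span R (Set.range a) := by
  apply le_antisymm
  · rw [span_coeffs_le_iff]
    intro m
    rw [coeff_sum_C_mul_X_pow]
    split_ifs with h
    · exact subset_span ⟨_, rfl⟩
    · exact zero_mem _
  · rw [span_le]
    rintro _ ⟨i, rfl⟩
    have h := coeff_mem_span_coeffs (R := R) (∑ i : Fin n, C (a i) * X ^ (i : ℕ)) i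
    rwa [coeff_sum_C_mul_X_pow, dif_pos i.2] at h

/-- **THE NORM COFACTOR: for a basis `b_0,…,b_{n−1}` of a commutative `K`-algebra `B`, the polynomial
`f = ∑ b_iX^i ∈ B[X]` divides a NONZERO polynomial of `K[X]`** — namely `ν = det Φ`, `Φ = ∑_i X^i·[b_i·]` the
matrix of multiplication by `f` on `B[X] = ⊕_j K[X]·b_j`, with cofactor `g = adj(Φ)` applied to the coordinates
of `1` (`Φ·adj Φ = det Φ`); `det Φ ≠ 0` because `f` is a non-zero-divisor of `B[X]` (McCoy: `y·f = 0` forces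
`y·b_i = 0` for all `i`, so `y = y·1 = 0`) and `Φv = 0 ⟹ f·(∑ v_jb_j) = 0`.  (The device by which a product
`fg` with SCALAR coefficients — a principal content — is produced; Cramer's rule ∕ the adjugate identity, cf. Dedekind's
norm forms.) [cite: HeinzerHuneke1998, footnote 1 (Dedekind's theorem on `c(f)c(g)` and `c(fg)`), p. 1306] -/
theorem exists_mul_sum_C_mul_X_pow_eq_map {n : ℕ} (b : Basis (Fin n) K B) :
    ∃ (g : B[X]) (ν : K[X]), ν ≠ 0 ∧ (∑ i : Fin n, C (b i) * X ^ (i : ℕ)) * g = ν.map (algebraMap K B) := by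
  classical
  set f : B[X] := ∑ i : Fin n, C (b i) * X ^ (i : ℕ) with hf
  set Φ : Matrix (Fin n) (Fin n) K[X] := Matrix.of fun l j => ∑ i : Fin n, C (b.repr (b i * b j) l) * X ^ (i : ℕ)
    with hΦ
  set Ψ : (Fin n → K[X]) → B[X] := fun v => ∑ j, (v j).map (algebraMap K B) * C (b j) with hΨ
  -- the multiplication table of `B`, read in `B[X]`
  have hmul : ∀ i j, C (b i) * C (b j) = ∑ l, (C (b.repr (b i * b j) l)).map (algebraMap K B) * C (b l) := by
    intro i j
    rw [← C_mul]
    conv_lhs => rw [← b.sum_repr (b i * b j)]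
    rw [map_sum]
    refine Finset.sum_congr rfl fun l _ => ?_
    rw [map_C, Algebra.smul_def, C_mul]
  -- the key identity `f·Ψ(v) = Ψ(Φv)`
  have hkey : ∀ v, f * Ψ v = Ψ (Φ.mulVec v) := by
    intro v
    set T : Fin n → Fin n → Fin n → B[X] :=
      fun i j l => X ^ (i : ℕ) * (v j).map (algebraMap K B) *
        ((C (b.repr (b i * b j) l)).map (algebraMap K B) * C (b l)) with hT
    have lhs : f * Ψ v = ∑ i, ∑ j, ∑ l, T i j l := by
      rw [hf, hΨ, Finset.sum_mul_sum]
      refine Finset.sum_congr rfl fun i _ => Finset.sum_congr rfl fun j _ => ?_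
      rw [show C (b i) * X ^ (i : ℕ) * ((v j).map (algebraMap K B) * C (b j)) =
          X ^ (i : ℕ) * (v j).map (algebraMap K B) * (C (b i) * C (b j)) by ring, hmul i j, Finset.mul_sum]
    have rhs : Ψ (Φ.mulVec v) = ∑ l, ∑ j, ∑ i, T i j l := by
      simp only [hΨ, Matrix.mulVec, dotProduct, hΦ, Matrix.of_apply]
      refine Finset.sum_congr rfl fun l _ => ?_
      rw [Polynomial.map_sum, Finset.sum_mul]
      refine Finset.sum_congr rfl fun j _ => ?_
      rw [Polynomial.map_mul, Polynomial.map_sum, Finset.sum_mul, Finset.sum_mul]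
      refine Finset.sum_congr rfl fun i _ => ?_
      rw [hT, Polynomial.map_mul, Polynomial.map_pow, map_X]
      ring
    rw [lhs, rhs]
    calc ∑ i, ∑ j, ∑ l, T i j l = ∑ j, ∑ i, ∑ l, T i j l := Finset.sum_comm
      _ = ∑ j, ∑ l, ∑ i, T i j l := Finset.sum_congr rfl fun j _ => Finset.sum_comm
      _ = ∑ l, ∑ j, ∑ i, T i j l := Finset.sum_comm
  -- `Ψ` is injective
  have hΨinj : ∀ v, Ψ v = 0 → v = 0 := by
    intro v hv
    funext j
    ext m
    have hc := congr_arg (fun q : B[X] => q.coeff m) hv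
    simp only [hΨ, finsetSum_coeff, coeff_mul_C, coeff_map, coeff_zero] at hc
    simp_rw [← Algebra.smul_def] at hc
    rw [Pi.zero_apply, coeff_zero]
    exact Fintype.linearIndependent_iff.1 b.linearIndependent _ hc j
  -- `f` is a non-zero-divisor (McCoy)
  have hf0 : f ∈ B[X]⁰ := by
    refine Polynomial.mem_nonZeroDivisors_iff.2 fun y hy => ?_
    have hyb : ∀ i : Fin n, y * b i = 0 := fun i => by
      have h1 : (y • f).coeff (i : ℕ) = 0 := by rw [hy, coeff_zero]
      rw [coeff_smul, hf, coeff_sum_C_mul_X_pow, dif_pos i.2, Fin.eta, smul_eq_mul] at h1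
      exact h1
    calc y = y * ∑ i, b.repr 1 i • b i := by rw [b.sum_repr, mul_one]
      _ = 0 := by
        rw [Finset.mul_sum]
        exact Finset.sum_eq_zero fun i _ => by rw [mul_smul_comm, hyb, smul_zero]
  -- hence `det Φ ≠ 0`
  have hdet : Φ.det ≠ 0 := by
    intro h0
    obtain ⟨v, hv, hΦv⟩ := Matrix.exists_mulVec_eq_zero_iff.2 h0
    refine hv (hΨinj v ?_)
    have h1 := hkey v
    have hΨ0 : Ψ 0 = 0 := by simp [hΨ]
    rw [hΦv, hΨ0] at h1
    exact (mul_left_mem_nonZeroDivisors_eq_zero_iff hf0).1 h1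
  -- the cofactor
  refine ⟨Ψ (Φ.adjugate.mulVec fun l => C (b.repr 1 l)), Φ.det, hdet, ?_⟩
  rw [hkey, Matrix.mulVec_mulVec, Matrix.mul_adjugate, Matrix.smul_mulVec, Matrix.one_mulVec]
  simp only [hΨ, Pi.smul_apply, smul_eq_mul, Polynomial.map_mul, map_C, mul_assoc]
  have h1 : ∑ l, C (algebraMap K B (b.repr 1 l)) * C (b l) = (1 : B[X]) := by
    calc ∑ l, C (algebraMap K B (b.repr 1 l)) * C (b l) = ∑ l, C (b.repr 1 l • b l) :=
          Finset.sum_congr rfl fun l _ => by rw [Algebra.smul_def, C_mul]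
      _ = C (∑ l, b.repr 1 l • b l) := by rw [map_sum]
      _ = 1 := by rw [b.sum_repr, map_one]
  rw [← Finset.mul_sum, h1, mul_one]

end Cofactor

section RationalContent

variable {A : Type*} [CommRing A] [Algebra ℚ A]

/-- **The `ℤ`-content of a nonzero RATIONAL polynomial `ν`, read in a `ℚ`-algebra `A`, is `ℤ·c·1_A` for a nonzero
rational `c`** (contents of polynomials over the quotient field of a principal ideal domain are principal
fractional ideals: Gauss ∕ Prüfer). [cite: ArnoldGilmer1970, p. 556 (the fractional ideals «generated by the coefficients»)] -/
theorem exists_span_coeffs_map_eq_span_singleton (ν : ℚ[X]) (hν : ν ≠ 0) :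
    ∃ c : ℚ, c ≠ 0 ∧ span ℤ ((ν.map (algebraMap ℚ A)).coeffs : Set A) = span ℤ {algebraMap ℚ A c} := by
  classical
  -- the content of `ν` over `ℤ` is a principal fractional ideal of `ℤ`
  set J : Submodule ℤ ℚ := span ℤ (ν.coeffs : Set ℚ) with hJ
  have hJfg : J.FG := ⟨ν.coeffs, rfl⟩
  let Jf : FractionalIdeal ℤ⁰ ℚ := ⟨J, FractionalIdeal.isFractional_of_fg hJfg⟩
  haveI hJp : (J : Submodule ℤ ℚ).IsPrincipal := FractionalIdeal.isPrincipal Jf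
  set c : ℚ := Submodule.IsPrincipal.generator J with hc
  have hJc : J = span ℤ {c} := (Submodule.IsPrincipal.span_singleton_generator J).symm
  have hc0 : c ≠ 0 := by
    intro h0
    apply hν
    have hJ0 : J = ⊥ := by rw [hJc, h0, span_singleton_eq_bot]
    ext m
    have hm : ν.coeff m ∈ J := coeff_mem_span_coeffs (R := ℤ) ν m
    rw [hJ0, mem_bot] at hm
    rw [hm, coeff_zero]
  -- transport along `q ↦ q·1`
  set ψ : ℚ →ₗ[ℤ] A := (Algebra.linearMap ℚ A).restrictScalars ℤ with hψ
  have hψ' : ∀ q, ψ q = algebraMap ℚ A q := fun q => rfl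
  have hmap : span ℤ ((ν.map (algebraMap ℚ A)).coeffs : Set A) = J.map ψ := by
    apply le_antisymm
    · rw [span_coeffs_le_iff]
      intro m
      rw [coeff_map, ← hψ']
      exact mem_map_of_mem (coeff_mem_span_coeffs (R := ℤ) ν m)
    · rw [map_le_iff_le_comap, hJ, span_le]
      intro q hq
      obtain ⟨m, -, rfl⟩ := mem_coeffs_iff.1 (Finset.mem_coe.1 hq)
      rw [SetLike.mem_coe, mem_comap, hψ', ← coeff_map]
      exact coeff_mem_span_coeffs (R := ℤ) _ m
  refine ⟨c, hc0, ?_⟩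
  rw [hmap, hJc, map_span, Set.image_singleton, hψ']

end RationalContent

/-! ## §2 `ℤ ⇢ ℤ_(p)`: spans over a subring of `ℚ` versus the tree's `p`-local membership -/

section SpanTower

variable {A : Type*} [CommRing A]
variable {S₀ : Type*} [CommRing S₀] [Algebra S₀ A]

/-- `S·(PQ) = (S·P)(S·Q)` for `ℤ`-submodules `P, Q` of an algebra and a ring of scalars `S` («`(L_1·L_2)_(p) =
(L_1)_(p)·(L_2)_(p)`»). [cite: HertlingLarabi2026, §7 Thm. 7.2 (a), chunk p0018] -/
theorem span_coe_mul (P Q : Submodule ℤ A) :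
    span S₀ (↑(P * Q) : Set A) = span S₀ (P : Set A) * span S₀ (Q : Set A) := by
  apply le_antisymm
  · rw [span_le]
    intro x hx
    refine Submodule.mul_induction_on hx (fun p hp q hq => mul_mem_mul (subset_span hp) (subset_span hq))
      fun x y hx hy => add_mem hx hy
  · rw [Submodule.span_mul_span]
    exact span_mono (Submodule.mul_subset_mul P Q)

/-- `S·(P^j) = (S·P)^j`. [cite: HertlingLarabi2026, §7 Thm. 7.2 (a), chunk p0018] -/
theorem span_coe_pow (P : Submodule ℤ A) : ∀ j : ℕ, span S₀ (↑(P ^ j) : Set A) = span S₀ (P : Set A) ^ j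
  | 0 => by
    rw [pow_zero, pow_zero, Submodule.one_eq_span, Submodule.span_span_of_tower, ← Submodule.one_eq_span]
  | j + 1 => by rw [pow_succ, pow_succ, span_coe_mul, span_coe_pow P j]

end SpanTower

section LocalBridge

variable {A : Type*} [CommRing A] [Algebra ℚ A]

/-- **Denominators: if `x ∈ ℤ_S·P` for the subring `ℤ_S = S⁻¹ℤ ⊂ ℚ` (Mathlib's `Localization.subalgebra.ofField`) and a
`ℤ`-submodule `P` of a `ℚ`-algebra, then `s·x ∈ P` for some `s ∈ S`** — for `S = ℤ ∖ pℤ` this is the `p`-local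
membership `x ∈ P_(p)` of the tree (`CMAlgebraLatticeLocalization`). [cite: HertlingLarabi2026, §7 Def. 7.1 (a) («`L_(p) := ℤ_(p)L`»), chunk p0018] -/
theorem exists_mem_smul_mem_of_mem_span_ofField (S : Submonoid ℤ) (hS : S ≤ ℤ⁰) (P : Submodule ℤ A) {x : A}
    (hx : x ∈ span (Localization.subalgebra.ofField ℚ S hS) (P : Set A)) : ∃ s ∈ S, (s : ℤ) • x ∈ P := by
  refine span_induction (fun y hy => ⟨1, S.one_mem, by rwa [one_smul]⟩)
    ⟨1, S.one_mem, by rw [smul_zero]; exact P.zero_mem⟩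
    (fun y z _ _ hy hz => ?_) (fun r y _ hy => ?_) hx
  · obtain ⟨s, hs, hsy⟩ := hy
    obtain ⟨s', hs', hs'z⟩ := hz
    refine ⟨s * s', S.mul_mem hs hs', ?_⟩
    rw [smul_add]
    refine P.add_mem ?_ ?_
    · rw [mul_comm, mul_smul]; exact P.smul_mem _ hsy
    · rw [mul_smul]; exact P.smul_mem _ hs'z
  · obtain ⟨s, hs, hsy⟩ := hy
    obtain ⟨a, s₀, hs₀, hr⟩ : ∃ (a s₀ : ℤ) (_ : s₀ ∈ S), (r : ℚ) = algebraMap ℤ ℚ a * (algebraMap ℤ ℚ s₀)⁻¹ := r.2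
    have hs₀0 : (s₀ : ℚ) ≠ 0 := by exact_mod_cast nonZeroDivisors.ne_zero (hS hs₀)
    refine ⟨s₀ * s, S.mul_mem hs₀ hs, ?_⟩
    have e : ((s₀ * s : ℤ)) • (r • y) = (a : ℤ) • ((s : ℤ) • y) := by
      rw [show r • y = (r : ℚ) • y from rfl, hr]
      simp only [← Int.cast_smul_eq_zsmul ℚ, smul_smul, eq_intCast, Int.cast_mul]
      congr 1
      field_simp
    rw [e]
    exact P.smul_mem _ hsy

end LocalBridge

/-! ## §3 The Dedekind–Mertens number of every polynomial over `Y` is at most `dim_ℚ Y` -/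

section Lattices

variable {t : Type} {L : t → Type} [∀ i, Field (L i)] [∀ i, NumberField (L i)] [Fintype t]

open Literature.NumberTheory.Automorphic

/-- **A finitely generated `ℤ`-submodule of `Y` is spanned by at most `dim_ℚ Y` elements** (it is free — a
torsion-free finitely generated `ℤ`-module — and a `ℤ`-basis is `ℚ`-linearly independent in `Y`).
[cite: HertlingLarabi2026, §2 Def. 2.1 (a) and Lemma 2.2 (a), chunk p0005] -/
theorem exists_finset_card_le_finrank_span_eq {N : Submodule ℤ (Π i, L i)} (hN : N.FG) :
    ∃ s : Finset (Π i, L i), s.card ≤ finrank ℚ (Π i, L i) ∧ span ℤ (s : Set (Π i, L i)) = N := by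
  classical
  haveI : Module.Finite ℤ N := Module.Finite.iff_fg.2 hN
  let β := Module.Free.chooseBasis ℤ N
  have hli : LinearIndependent ℚ (fun k => (β k : Π i, L i)) :=
    (LinearIndependent.iff_fractionRing ℤ ℚ).1 (β.linearIndependent.map' N.subtype (Submodule.ker_subtype N))
  refine ⟨Finset.univ.image fun k => (β k : Π i, L i), ?_, ?_⟩
  · calc (Finset.univ.image fun k => (β k : Π i, L i)).card
        ≤ Fintype.card (Module.Free.ChooseBasisIndex ℤ N) := Finset.card_image_le.trans (by rw [Finset.card_univ])
      _ ≤ finrank ℚ (Π i, L i) := hli.fintype_card_le_finrank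
  · rw [Finset.coe_image, Finset.coe_univ, Set.image_univ]
    apply le_antisymm
    · rw [span_le]
      rintro _ ⟨k, rfl⟩
      exact (β k).2
    · intro x hx
      have h1 := β.sum_repr ⟨x, hx⟩
      have h2 := congrArg (fun y : N => (y : Π i, L i)) h1
      simp only [Submodule.coe_sum, Submodule.coe_smul] at h2
      rw [← h2]
      exact sum_mem fun k _ => smul_mem _ _ (subset_span ⟨k, rfl⟩)

/-- **THE DEDEKIND–MERTENS–HEINZER–HUNEKE FORMULA FOR LATTICE CONTENTS: `c(f)^n·c(g) ⊆ c(f)^{n−1}·c(fg)` for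
ALL `f, g ∈ Y[X]`, `n = dim_ℚ Y`, `c(·) = ℤ`-span of the coefficients** — i.e. the Dedekind–Mertens number of every
polynomial over `Y` (with respect to `ℤ`-contents) is at most `n`: `c(g)` is free of rank `≤ n`, so at each prime
`p` the `ℤ_(p)`-content `ℤ_(p)c(g)` is spanned by `≤ n` elements and HH Lemma 2.2 applies over the local ring
`ℤ_(p)`; «`c(f)^nc(f)c(g) = c(f)^nc(fg)` holds in `R` if and only if [it holds in] `R_m` for each maximal ideal `m`»
is the tree's `mem_of_forall_prime_exists_not_dvd_smul_mem`. [cite: HeinzerHuneke1998, Thm. 2.1 (proof: reduction to `R_m`) and Lemma 2.2, p. 1307]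
[cite: HunekeSwanson2006, §1.7 Thm. 1.7.3, p. 18] -/
theorem span_coeffs_pow_finrank_mul_le (f g : (Π i, L i)[X]) :
    span ℤ (f.coeffs : Set (Π i, L i)) ^ finrank ℚ (Π i, L i) * span ℤ (g.coeffs : Set (Π i, L i)) ≤
      span ℤ (f.coeffs : Set (Π i, L i)) ^ (finrank ℚ (Π i, L i) - 1) *
        span ℤ ((f * g).coeffs : Set (Π i, L i)) := by
  classical
  obtain ⟨s, hs, hsg⟩ := exists_finset_card_le_finrank_span_eq (span_coeffs_fg (R := ℤ) g)
  intro x hx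
  refine mem_of_forall_prime_exists_not_dvd_smul_mem fun p hp => ?_
  -- the local ring `ℤ_(p) ⊂ ℚ`
  haveI hP : (Ideal.span {(p : ℤ)}).IsPrime :=
    (Ideal.span_singleton_prime (by exact_mod_cast hp.ne_zero)).2 (Nat.prime_iff_prime_int.1 hp)
  set R₀ := Localization.subalgebra.ofField ℚ (Ideal.span {(p : ℤ)}).primeCompl
    (Ideal.primeCompl_le_nonZeroDivisors _) with hR₀
  haveI : IsLocalRing R₀ := IsLocalization.AtPrime.isLocalRing R₀ (Ideal.span {(p : ℤ)})
  -- HH Lemma 2.2 over `ℤ_(p)`: `c₀(f)^n c₀(g) ⊆ c₀(f)^{n-1} c₀(fg)`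
  have hs₀ : span R₀ (s : Set (Π i, L i)) = span R₀ (g.coeffs : Set (Π i, L i)) := by
    rw [← Submodule.span_span_of_tower ℤ R₀ (s : Set (Π i, L i)), hsg, Submodule.span_span_of_tower]
  have hloc := span_coeffs_pow_mul_le (R := R₀) f g s hs₀ hs
  have e₁ : span R₀ (f.coeffs : Set (Π i, L i)) ^ finrank ℚ (Π i, L i) * span R₀ (g.coeffs : Set (Π i, L i)) =
      span R₀ (↑(span ℤ (f.coeffs : Set (Π i, L i)) ^ finrank ℚ (Π i, L i) *
        span ℤ (g.coeffs : Set (Π i, L i))) : Set (Π i, L i)) := by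
    rw [span_coe_mul, span_coe_pow, Submodule.span_span_of_tower, Submodule.span_span_of_tower]
  have e₂ : span R₀ (f.coeffs : Set (Π i, L i)) ^ (finrank ℚ (Π i, L i) - 1) *
        span R₀ ((f * g).coeffs : Set (Π i, L i)) =
      span R₀ (↑(span ℤ (f.coeffs : Set (Π i, L i)) ^ (finrank ℚ (Π i, L i) - 1) *
        span ℤ ((f * g).coeffs : Set (Π i, L i))) : Set (Π i, L i)) := by
    rw [span_coe_mul, span_coe_pow, Submodule.span_span_of_tower, Submodule.span_span_of_tower]
  have hx₁ : x ∈ span R₀ (↑(span ℤ (f.coeffs : Set (Π i, L i)) ^ (finrank ℚ (Π i, L i) - 1) *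
      span ℤ ((f * g).coeffs : Set (Π i, L i))) : Set (Π i, L i)) := by
    rw [← e₂]
    exact hloc (e₁ ▸ subset_span hx)
  obtain ⟨s', hs', hmem⟩ := exists_mem_smul_mem_of_mem_span_ofField _ _ _ hx₁
  exact ⟨s', fun hdvd => hs' (Ideal.mem_span_singleton.2 hdvd), hmem⟩

/-- **The content formula as an EQUALITY: `c(f)^n·c(g) = c(f)^{n−1}·c(fg)` for all `f, g ∈ Y[X]`**, `n = dim_ℚ Y ≥ 1`
(the reverse inclusion is `c(fg) ⊆ c(f)c(g)`). [cite: HeinzerHuneke1998, Thm. 2.1, p. 1307] [cite: HunekeSwanson2006, §1.7 Thm. 1.7.3, p. 18] -/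
theorem span_coeffs_pow_finrank_mul_eq (f g : (Π i, L i)[X]) (hn : 1 ≤ finrank ℚ (Π i, L i)) :
    span ℤ (f.coeffs : Set (Π i, L i)) ^ finrank ℚ (Π i, L i) * span ℤ (g.coeffs : Set (Π i, L i)) =
      span ℤ (f.coeffs : Set (Π i, L i)) ^ (finrank ℚ (Π i, L i) - 1) *
        span ℤ ((f * g).coeffs : Set (Π i, L i)) := by
  refine le_antisymm (span_coeffs_pow_finrank_mul_le f g) ?_
  calc span ℤ (f.coeffs : Set (Π i, L i)) ^ (finrank ℚ (Π i, L i) - 1) * span ℤ ((f * g).coeffs : Set (Π i, L i))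
      ≤ span ℤ (f.coeffs : Set (Π i, L i)) ^ (finrank ℚ (Π i, L i) - 1) *
          (span ℤ (f.coeffs : Set (Π i, L i)) * span ℤ (g.coeffs : Set (Π i, L i))) :=
        mul_le_mul' le_rfl (span_coeffs_mul_le f g)
    _ = _ := by rw [← mul_assoc, ← pow_succ, Nat.sub_add_cancel hn]

/-! ## §4 DTZ62 THEOREM C ∕ HL THM. 10.1: `L^k` is invertible for every full lattice `L` and every `k ≥ n − 1` -/

omit [∀ i, NumberField (L i)] [Fintype t] in
/-- `ℤu·P = uP` for a unit `u` of `Y`. [cite: HertlingLarabi2026, §1 («`aL`, `a ∈ A^{unit}`»), chunk p0003] -/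
theorem span_singleton_mul_eq_units_smul (u : (Π i, L i)ˣ) (P : Submodule ℤ (Π i, L i)) :
    span ℤ {(u : Π i, L i)} * P = u • P := by
  ext x
  rw [Submodule.mem_span_singleton_mul, mem_units_smul_submodule_iff]
  constructor
  · rintro ⟨z, hz, rfl⟩
    rwa [Units.smul_def, smul_eq_mul, ← mul_assoc, Units.inv_mul, one_mul]
  · intro h
    exact ⟨_, h, by rw [Units.smul_def, smul_eq_mul, ← mul_assoc, Units.mul_inv, one_mul]⟩

omit [∀ i, NumberField (L i)] [Fintype t] in
/-- `(uP)^j = u^jP^j`. [cite: HertlingLarabi2026, §4 (4.4) (classes of powers), chunk p0009] -/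
theorem units_smul_pow (u : (Π i, L i)ˣ) (P : Submodule ℤ (Π i, L i)) :
    ∀ j : ℕ, (u • P) ^ j = (u ^ j) • P ^ j
  | 0 => by rw [pow_zero, pow_zero, pow_zero, one_smul]
  | j + 1 => by
    rw [pow_succ, units_smul_pow u P j, pow_succ, pow_succ, ← units_smul_mul, mul_comm (P ^ j) (u • P),
      ← units_smul_mul, smul_smul, mul_comm P (P ^ j), mul_comm (u ^ j) u]

/-- **DTZ62 THEOREM C ∕ HL 2026 THEOREM 10.1 ∕ Si70 — THE STRUCTURE BEHIND IT: for a full lattice `M` of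
`Y = ∏ Lᵢ`, `n = dim_ℚ Y ≥ 1`, there are a lattice `N` and a unit `u` with `M^{k+1}·N = u·M^k` for all `k ≥ n − 1`**
(`N` = the `ℤ`-content of the norm cofactor `g` of `f = ∑ ω_iX^i`, `ω` a `ℤ`-basis of `M`, `u = c·1` the generator
of `c(fg)`; the content formula of §3 gives `M^n·N = u·M^{n−1}`). [cite: HertlingLarabi2026, §10 Thm. 10.1, chunk p0026]
[cite: HeinzerHuneke1998, Lemma 2.2, p. 1307] -/
theorem exists_pow_succ_mul_eq_units_smul_pow {M : Submodule ℤ (Π i, L i)} (hM : IsFullLattice (Π i, L i) M)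
    (hn : 1 ≤ finrank ℚ (Π i, L i)) :
    ∃ (N : Submodule ℤ (Π i, L i)) (u : (Π i, L i)ˣ), (u : Π i, L i) ∈ M * N ∧
      ∀ k : ℕ, finrank ℚ (Π i, L i) - 1 ≤ k → M ^ (k + 1) * N = u • M ^ k := by
  classical
  set n := finrank ℚ (Π i, L i) with hn_def
  obtain ⟨ω, hω⟩ := exists_basis_fin_span_eq_of_isFullLattice hM
  obtain ⟨g, ν, hν, hfg⟩ := exists_mul_sum_C_mul_X_pow_eq_map ω
  obtain ⟨c, hc, hcν⟩ := exists_span_coeffs_map_eq_span_singleton (A := Π i, L i) ν hν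
  set f : (Π i, L i)[X] := ∑ i : Fin n, C (ω i) * X ^ (i : ℕ) with hf
  have hcf : span ℤ (f.coeffs : Set (Π i, L i)) = M := by rw [hf, span_coeffs_sum_C_mul_X_pow, hω]
  set u : (Π i, L i)ˣ := Units.map (algebraMap ℚ (Π i, L i) : ℚ →* Π i, L i) (Units.mk0 c hc) with hu
  have hu' : (u : Π i, L i) = algebraMap ℚ (Π i, L i) c := by rw [hu, Units.coe_map, Units.val_mk0]; rfl
  have hcfg : span ℤ ((f * g).coeffs : Set (Π i, L i)) = span ℤ {(u : Π i, L i)} := by rw [hfg, hcν, hu']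
  set N := span ℤ (g.coeffs : Set (Π i, L i)) with hN
  -- the content formula: `M^n N = u M^{n-1}`
  have hle : M ^ n * N ≤ u • M ^ (n - 1) := by
    have h := span_coeffs_pow_finrank_mul_le f g
    rwa [hcf, hcfg, mul_comm (M ^ (n - 1)), span_singleton_mul_eq_units_smul] at h
  have huMN : (u : Π i, L i) ∈ M * N := by
    have h := span_coeffs_mul_le (R := ℤ) f g
    rw [hcf, hcfg, span_singleton_le_iff_mem] at h
    exact h
  have hge : u • M ^ (n - 1) ≤ M ^ n * N := by
    rw [← span_singleton_mul_eq_units_smul, mul_comm]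
    calc M ^ (n - 1) * span ℤ {(u : Π i, L i)} ≤ M ^ (n - 1) * (M * N) :=
        mul_le_mul' le_rfl ((span_singleton_le_iff_mem _ _).2 huMN)
      _ = M ^ n * N := by rw [← mul_assoc, ← pow_succ, Nat.sub_add_cancel hn]
  have hstar : M ^ n * N = u • M ^ (n - 1) := le_antisymm hle hge
  refine ⟨N, u, huMN, fun k hk => ?_⟩
  obtain ⟨j, rfl⟩ := Nat.exists_eq_add_of_le hk
  calc M ^ (n - 1 + j + 1) * N = M ^ j * (M ^ n * N) := by
        rw [mul_comm (M ^ j), mul_assoc, mul_comm N, ← mul_assoc, ← pow_add]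
        congr 2
        omega
    _ = u • M ^ (n - 1 + j) := by rw [hstar, mul_comm, ← units_smul_mul, pow_add]

/-- **DADE–TAUSSKY–ZASSENHAUS'S THEOREM C ∕ HERTLING–LARABI'S THEOREM 10.1 ∕ SINGER 1970, UNCONDITIONALLY, WITH THE
COMMON ORDER OF THE HIGH POWERS: for a full lattice `M` of `Y = ∏ Lᵢ`, `n = dim_ℚ Y ≥ 1`, there is an order `Λ_2`
(`1 ∈ Λ_2 = Λ_2Λ_2`) such that for every `k ≥ n − 1` the power `M^k` is invertible — `M^k·(𝒪(M^k):M^k) = 𝒪(M^k)` —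
with `𝒪(M^k) = Λ_2`** («For each full lattice `L ∈ 𝓛(A)` each power `L^k` with `k ≥ n−1` is invertible»; HL's proof
ends «`L^{n−1+l}` is invertible for `l ≥ 0` with `𝒪(L^{n−1+l}) = Λ_2`»).  Here `Λ_2 = E^k`, `E = u⁻¹MN ∋ 1`,
`E·M^k = M^k`, `E^{k+1} = E^k` for `k ≥ n − 1`, and `M^k·u^{−k}N^k = Λ_2`, with `N`, `u` from
`exists_pow_succ_mul_eq_units_smul_pow`. [cite: HertlingLarabi2026, §10 Thm. 10.1 and end of its proof, chunks p0026–p0028]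
[cite: DadeTausskyZassenhaus1962, §1.5 Theorem C (as cited by HertlingLarabi2026 §10)] [cite: Singer1970, main theorem (as cited by HertlingLarabi2026 §10)] -/
theorem exists_order_forall_pow_mul_div_div_eq {M : Submodule ℤ (Π i, L i)} (hM : IsFullLattice (Π i, L i) M)
    (hn : 1 ≤ finrank ℚ (Π i, L i)) :
    ∃ Λ₂ : Submodule ℤ (Π i, L i), (1 : Π i, L i) ∈ Λ₂ ∧ Λ₂ * Λ₂ = Λ₂ ∧
      ∀ k : ℕ, finrank ℚ (Π i, L i) - 1 ≤ k →
        M ^ k * ((M ^ k / M ^ k) / M ^ k) = M ^ k / M ^ k ∧ M ^ k / M ^ k = Λ₂ := by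
  classical
  set n := finrank ℚ (Π i, L i) with hn_def
  obtain ⟨N, u, huMN, hstar⟩ := exists_pow_succ_mul_eq_units_smul_pow hM hn
  set E : Submodule ℤ (Π i, L i) := u⁻¹ • (M * N) with hE
  -- `1 ∈ E`
  have h1E : (1 : Π i, L i) ∈ E := by
    rw [hE, mem_units_smul_submodule_iff, inv_inv, Units.smul_def, smul_eq_mul, mul_one]
    exact huMN
  -- `E·M^k = M^k` for `k ≥ n-1`
  have hEM : ∀ k, n - 1 ≤ k → E * M ^ k = M ^ k := fun k hk => by
    rw [hE, ← units_smul_mul, mul_comm M N, mul_assoc, ← pow_succ', mul_comm N, hstar k hk, smul_smul,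
      inv_mul_cancel, one_smul]
  -- `E^{k+1} = E^k` for `k ≥ n-1`
  have hEpow : ∀ k, E ^ k = (u⁻¹ ^ k) • (M ^ k * N ^ k) := fun k => by rw [hE, units_smul_pow, mul_pow]
  have hEstab : ∀ k, n - 1 ≤ k → E ^ (k + 1) = E ^ k := fun k hk => by
    rw [hEpow, hEpow, pow_succ N, ← mul_assoc, mul_right_comm, hstar k hk, ← units_smul_mul, smul_smul, pow_succ,
      mul_assoc, inv_mul_cancel, mul_one]
  have hEstab' : ∀ k, n - 1 ≤ k → ∀ j, E ^ (k + j) = E ^ k := fun k hk j => by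
    induction j with
    | zero => rw [add_zero]
    | succ j ih => rw [← add_assoc, hEstab _ (hk.trans (Nat.le_add_right k j)), ih]
  have h1Ek : ∀ k, (1 : Π i, L i) ∈ E ^ k := fun k => by
    induction k with
    | zero => rw [pow_zero]; exact Submodule.one_le.mp le_rfl
    | succ k ih => rw [pow_succ]; simpa only [mul_one] using mul_mem_mul ih h1E
  have hEkM : ∀ k, n - 1 ≤ k → ∀ j, E ^ j * M ^ k = M ^ k := fun k hk j => by
    induction j with
    | zero => rw [pow_zero, one_mul]
    | succ j ih => rw [pow_succ, mul_assoc, hEM k hk, ih]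
  refine ⟨E ^ (n - 1), h1Ek _, ?_, fun k hk => ?_⟩
  · rw [← pow_add, hEstab' _ le_rfl]
  · -- `Λ₂ = E^k = E^{n-1}`, `M^k · u^{-k}N^k = E^k`
    set Λ₂ := E ^ k with hΛ₂
    have hΛk : E ^ (n - 1) = Λ₂ := by
      obtain ⟨j, rfl⟩ := Nat.exists_eq_add_of_le hk
      rw [hΛ₂, hEstab' _ le_rfl]
    have hΛΛ : Λ₂ * Λ₂ = Λ₂ := by rw [hΛ₂, ← pow_add, hEstab' _ hk]
    have h1Λ : (1 : Π i, L i) ∈ Λ₂ := h1Ek k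
    have hΛM : Λ₂ * M ^ k = M ^ k := hEkM k hk k
    have hML : M ^ k * ((u⁻¹ ^ k) • N ^ k) = Λ₂ := by
      rw [hΛ₂, hEpow, mul_comm, ← units_smul_mul, mul_comm]
    -- `Λ₂ ⊆ 𝒪(M^k)` and `Λ₂𝒪 = 𝒪`
    have hΛO : Λ₂ ≤ M ^ k / M ^ k := Submodule.le_div_iff_mul_le.2 hΛM.le
    have hΛOO : Λ₂ * (M ^ k / M ^ k) = M ^ k / M ^ k := by
      refine le_antisymm ?_ fun x hx => ?_
      · calc Λ₂ * (M ^ k / M ^ k) ≤ (M ^ k / M ^ k) * (M ^ k / M ^ k) := mul_le_mul' hΛO le_rfl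
          _ = M ^ k / M ^ k := div_self_mul_div_self_eq _
      · rw [← one_mul x]
        exact mul_mem_mul h1Λ hx
    -- invertibility
    have hinv : M ^ k * ((M ^ k / M ^ k) / M ^ k) = M ^ k / M ^ k :=
      mul_div_div_eq_of_exists_mul_eq ⟨(u⁻¹ ^ k) • N ^ k * (M ^ k / M ^ k), by rw [← mul_assoc, hML, hΛOO]⟩
    refine ⟨hinv, ?_⟩
    -- `𝒪(M^k) = Λ₂`
    rw [hΛk]
    refine le_antisymm (fun x hx => ?_) hΛO
    have h2 : x * 1 ∈ (M ^ k / M ^ k) * Λ₂ := mul_mem_mul hx h1Λ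
    rw [mul_one, ← hML, ← mul_assoc, div_self_mul_self] at h2
    rwa [← hML]

/-- **DTZ62 THEOREM C ∕ HL 2026 THM. 10.1 ∕ Si70: for every full lattice `M` of `Y = ∏ Lᵢ` and every `k ≥ dim_ℚ Y − 1`,
the power `M^k` is invertible, `M^k·(𝒪(M^k):M^k) = 𝒪(M^k)`** («For each full lattice `L ∈ 𝓛(A)` each power `L^k`
with `k ≥ n−1` is invertible»). [cite: HertlingLarabi2026, §10 Thm. 10.1, chunk p0026]
[cite: DadeTausskyZassenhaus1962, §1.5 Theorem C (as cited by HertlingLarabi2026 §10)] [cite: Singer1970, main theorem (as cited by HertlingLarabi2026 §10)] -/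
theorem pow_mul_div_div_eq {M : Submodule ℤ (Π i, L i)} (hM : IsFullLattice (Π i, L i) M) {k : ℕ}
    (hk : finrank ℚ (Π i, L i) - 1 ≤ k) : M ^ k * ((M ^ k / M ^ k) / M ^ k) = M ^ k / M ^ k := by
  rcases Nat.eq_zero_or_pos (finrank ℚ (Π i, L i)) with h0 | hn
  · -- `Y = 0`: every submodule is `⊥`
    haveI : Subsingleton (Π i, L i) := Module.finrank_zero_iff.1 h0
    exact Subsingleton.elim _ _
  · obtain ⟨Λ₂, -, -, h⟩ := exists_order_forall_pow_mul_div_div_eq hM hn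
    exact (h k hk).1

/-- **The orders of all high powers agree: `𝒪(M^k) = 𝒪(M^{n−1})` for `k ≥ n − 1`** («with `𝒪(L^{n−1+l}) = Λ_2`»).
[cite: HertlingLarabi2026, §10 proof of Thm. 10.1 (last sentence), chunk p0028] -/
theorem pow_div_pow_eq_of_le {M : Submodule ℤ (Π i, L i)} (hM : IsFullLattice (Π i, L i) M) {k : ℕ}
    (hk : finrank ℚ (Π i, L i) - 1 ≤ k) :
    M ^ k / M ^ k = M ^ (finrank ℚ (Π i, L i) - 1) / M ^ (finrank ℚ (Π i, L i) - 1) := by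
  rcases Nat.eq_zero_or_pos (finrank ℚ (Π i, L i)) with h0 | hn
  · haveI : Subsingleton (Π i, L i) := Module.finrank_zero_iff.1 h0
    exact Subsingleton.elim _ _
  · obtain ⟨Λ₂, -, -, h⟩ := exists_order_forall_pow_mul_div_div_eq hM hn
    rw [(h k hk).2, (h _ le_rfl).2]

/-! ## Theorem 1.3 (e) in the semigroup `W(𝓛(Y))` of weak classes (row g34-#7)

HL's main results are about the semigroups `𝓛(A)`, `𝓔(A)` and `W(𝓛(A)) = W(𝓔(A))` (Lemma 1.2 (c)): «for an
idempotent `c ∈ S`, `G(c) = [c]_w`» (§1, before Lemma 1.2), «the idempotents in `𝓛(A)` are the orders» (Lemma 1.2 (a)),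
and Theorem 1.3 (e) = Theorem 10.1 closes with «`L^{n−1+l} ∼_w L_2^{n−1+l} = Λ_2` for `l ≥ 0`, so by Theorem 4.4 (c)
and Theorem 5.7 (b) `L^{n−1+l}` is invertible for `l ≥ 0` with `𝒪(L^{n−1+l}) = Λ_2`».  Weak equivalence is written,
as everywhere in this library, `1 ∈ (L_1:L_2)·(L_2:L_1)` (`CMAlgebraLatticeWeakEquivalence`, HL Thm. 4.4 ∕ 5.7). -/

/-- **THEOREM 1.3 (e) IN `W(𝓛(Y))`: for a full lattice `M` and every `k ≥ dim_ℚ Y − 1`, `M^k ∼_w 𝒪(M^k)` — the weak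
class `[M^k]_w = [M]_w^k` lies in (indeed is, `G(c) = [c]_w`) the group `G(𝒪(M^k))` of the idempotent `𝒪(M^k)`**
(HL: «`L^{n−1+l} ∼_w L_2^{n−1+l} = Λ_2` for `l ≥ 0`» with `Λ_2 = 𝒪(L^{n−1+l})`; here from `pow_mul_div_div_eq` and
Thm. 5.8 (b) ∕ 4.4 (b) `one_mem_div_mul_div_order_iff`). [cite: HertlingLarabi2026, §1 Thm. 1.3 (e) with Lemma 1.2, and §10 end of the proof of Thm. 10.1, chunks p0003, p0028]
[cite: DadeTausskyZassenhaus1962, §1.5 Theorem C (as cited by HertlingLarabi2026 §10)] -/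
theorem one_mem_pow_div_order_mul_order_div_pow {M : Submodule ℤ (Π i, L i)} (hM : IsFullLattice (Π i, L i) M)
    {k : ℕ} (hk : finrank ℚ (Π i, L i) - 1 ≤ k) :
    (1 : Π i, L i) ∈ (M ^ k / (M ^ k / M ^ k)) * ((M ^ k / M ^ k) / M ^ k) :=
  (one_mem_div_mul_div_order_iff (one_mem_div_self _) (div_self_mul_div_self_eq _).le).2
    ⟨rfl, pow_mul_div_div_eq hM hk⟩

/-- **All high powers of a full lattice are weakly equivalent to one another: `M^k ∼_w M^{k'}` for `k, k' ≥ dim_ℚ Y − 1`**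
(both are `∼_w Λ_2 = 𝒪(M^k) = 𝒪(M^{k'})`, `pow_div_pow_eq_of_le`; transitivity and symmetry of `∼_w`, Thm. 4.4 (a)).
[cite: HertlingLarabi2026, §10 end of the proof of Thm. 10.1 («`L^{n−1+l} ∼_w … = Λ_2` for `l ≥ 0`»), chunk p0028; §4 Thm. 4.4 (a), chunk p0009] -/
theorem one_mem_pow_div_pow_mul_pow_div_pow {M : Submodule ℤ (Π i, L i)} (hM : IsFullLattice (Π i, L i) M)
    {k k' : ℕ} (hk : finrank ℚ (Π i, L i) - 1 ≤ k) (hk' : finrank ℚ (Π i, L i) - 1 ≤ k') :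
    (1 : Π i, L i) ∈ (M ^ k / M ^ k') * (M ^ k' / M ^ k) := by
  have h := one_mem_pow_div_order_mul_order_div_pow hM hk
  have h' := one_mem_pow_div_order_mul_order_div_pow hM hk'
  rw [pow_div_pow_eq_of_le hM hk] at h
  rw [pow_div_pow_eq_of_le hM hk'] at h'
  exact one_mem_div_mul_div_trans h ((one_mem_div_mul_div_comm _ _).1 h')

/-- **The weak class of a high power is IDEMPOTENT: `M^k·M^k ∼_w M^k` for `k ≥ dim_ℚ Y − 1`** — Thm. 4.4 (c)
«`L` invertible ⟺ `LL ∼_w L`» read through Thm. 10.1; here directly: `M^kM^k = M^{2k}` and `2k ≥ k ≥ n − 1`.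
[cite: HertlingLarabi2026, §4 Thm. 4.4 (c) with §10 Thm. 10.1, chunks p0009–p0010, p0026] -/
theorem one_mem_pow_mul_pow_div_pow_mul_pow_div_pow_mul_pow {M : Submodule ℤ (Π i, L i)}
    (hM : IsFullLattice (Π i, L i) M) {k : ℕ} (hk : finrank ℚ (Π i, L i) - 1 ≤ k) :
    (1 : Π i, L i) ∈ ((M ^ k * M ^ k) / M ^ k) * (M ^ k / (M ^ k * M ^ k)) := by
  rw [← pow_add]
  exact one_mem_pow_div_pow_mul_pow_div_pow hM (hk.trans (Nat.le_add_right k k)) hk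

end Lattices

end Literature.NumberTheory.ComplexMultiplication
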